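import Mathlib
import Summits.KontsevichZagierPeriods.KontsevichZagierPeriods.Theorems.IsogenyCertificatesJLPairCalculus
import HarnessLib

/-!
# The Jacquet–Langlands correspondence for `X_0^{35}`: images of the real branches

Support file for `JLPairIdentityX` (stmt-KontsevichZagierPeriods-14655): decay at `−∞`
(`x_b + 1/4 ≤ K/u²`, `x_t + 4/9 ≤ K'/u²`, from kernel-checked coefficient bounds) and the images
`x_b((−∞,−1)) = (−1/4, 0)`, `x_t((−∞,u_m)) = x_t((u_m,−1)) = (−4/9, x_t(u_m))` (intermediate value
theorem): the big branch sweeps the big oval once, the tiny branch runs out and back.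
-/

namespace Summit.KontsevichZagierPeriods.IsogenyCertificates.JLPair

open Literature.Algebra.Polynomial

/-! ### Behaviour at `−∞` and the images of the branches -/

section Images

open Set Filter Topology

/-- `S·u¹⁶ + (16P₂ + 4P₁ + Q) ≥ 0` on `(−∞,−1]`, `S = 115296020` (certificate after `u = −1 − t`).
[folklore] -/
theorem B14_lower {u : ℝ} (hu : u ≤ -1) : -(115296020 * u ^ 16) ≤ CoeffList.eval u cB14 := by
  have ht : (0 : ℝ) ≤ -1 - u := by linarith
  have h := CoeffList.eval_nonneg_of_coeffs (R := ℝ) ht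
    (CoeffList.comp (CoeffList.add [0,0,0,0,0,0,0,0,0,0,0,0,0,0,0,0,115296020] cB14) [-1, -1]) (by decide +kernel)
  rw [CoeffList.eval_comp, CoeffList.eval_add] at h
  have hu' : CoeffList.eval (-1 - u) [-1, -1] = u := by simp [CoeffList.eval_cons]
  rw [hu'] at h
  simp [CoeffList.eval_cons] at h
  nlinarith [h]

/-- `(81P₂ + 36P₁ + 16Q) ≤ S'·u¹⁶` on `(−∞,−1]`, `S' = 11030810`. [folklore] -/
theorem B49_upper {u : ℝ} (hu : u ≤ -1) : CoeffList.eval u cB49 ≤ 11030810 * u ^ 16 := by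
  have ht : (0 : ℝ) ≤ -1 - u := by linarith
  have h := CoeffList.eval_nonneg_of_coeffs (R := ℝ) ht
    (CoeffList.comp (CoeffList.sub [0,0,0,0,0,0,0,0,0,0,0,0,0,0,0,0,11030810] cB49) [-1, -1]) (by decide +kernel)
  rw [CoeffList.eval_comp, CoeffList.eval_sub] at h
  have hu' : CoeffList.eval (-1 - u) [-1, -1] = u := by simp [CoeffList.eval_cons]
  rw [hu'] at h
  simp [CoeffList.eval_cons] at h
  nlinarith [h]

/-- `Q ≥ 36 u¹⁸` on `(−∞,−1]`. [folklore] -/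
theorem Q_lower {u : ℝ} (hu : u ≤ -1) : 36 * u ^ 18 ≤ CoeffList.eval u cQ := by
  have h := Q_sub_lead_pos hu
  rw [CoeffList.eval_add] at h
  simp [CoeffList.eval_cons] at h
  nlinarith [h]

/-- **Decay of `x_b + 1/4` at `−∞`**: `0 < x_b(u) + 1/4 ≤ K/u²` for `u < −1`, with
`K = 100·115296020/(304·36)`. [folklore] -/
theorem xb_add_quarter_le {u : ℝ} (hu : u < -1) :
    xb u + 1 / 4 ≤ (100 * 115296020 / (304 * 36)) / u ^ 2 := by
  have hQ := Q_pos hu.le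
  have hprod := shift_mul hu.le (1 / 4)
  have hxt : xt u + 1 / 4 < -(19 / 100) := by linarith [xt_lt hu.le]
  have hxb : 0 < xb u + 1 / 4 := by linarith [xb_gt hu]
  have hB : CoeffList.eval u cB14 = 16 * (CoeffList.eval u cP2 + 1 / 4 * CoeffList.eval u cP1 +
      (1 / 4) ^ 2 * CoeffList.eval u cQ) := by
    simp only [cB14, CoeffList.eval_add, CoeffList.eval_smul]; push_cast; ring
  -- (xb + 1/4) * (-(xt + 1/4)) = -B14/(16 Q)
  have hneg : (xb u + 1 / 4) * (-(xt u + 1 / 4)) = -CoeffList.eval u cB14 / (16 * CoeffList.eval u cQ) := by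
    rw [hB, mul_neg, hprod]; field_simp
  have hlow := B14_lower hu.le
  have hQl := Q_lower hu.le
  have hu2 : 1 ≤ u ^ 2 := by nlinarith
  have hu16 : 0 < u ^ 16 := by rw [show u ^ 16 = (u ^ 2) ^ 8 by ring]; exact pow_pos (by nlinarith) 8
  have hu18 : (1 : ℝ) ≤ u ^ 18 := by rw [show u ^ 18 = (u ^ 2) ^ 9 by ring]; exact one_le_pow₀ hu2
  -- from hneg: (xb + 1/4) = (-B14/(16Q)) / (-(xt+1/4)) ≤ (S u^16/(16·36 u^18)) / (19/100)
  have h1 : (xb u + 1 / 4) * (19 / 100) ≤ (xb u + 1 / 4) * (-(xt u + 1 / 4)) :=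
    mul_le_mul_of_nonneg_left (by linarith) hxb.le
  rw [hneg] at h1
  have h2 : -CoeffList.eval u cB14 / (16 * CoeffList.eval u cQ) ≤ 115296020 * u ^ 16 / (16 * (36 * u ^ 18)) := by
    apply div_le_div₀ (by positivity) (by linarith) (by nlinarith) (by nlinarith)
  have h3 : (115296020 : ℝ) * u ^ 16 / (16 * (36 * u ^ 18)) = 115296020 / (16 * 36) / u ^ 2 := by
    field_simp
  rw [h3] at h2
  have h4 : xb u + 1 / 4 ≤ (115296020 / (16 * 36) / u ^ 2) / (19 / 100) := by
    rw [le_div_iff₀ (by norm_num : (0:ℝ) < 19 / 100)]; linarith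
  calc xb u + 1 / 4 ≤ (115296020 / (16 * 36) / u ^ 2) / (19 / 100) := h4
    _ = (100 * 115296020 / (304 * 36)) / u ^ 2 := by field_simp; ring

/-- **Decay of `x_t + 4/9` at `−∞`**: `x_t(u) + 4/9 ≤ K'/u²` for `u < −1`, `K' = 11030810/567`.
[folklore] -/
theorem xt_add_le {u : ℝ} (hu : u < -1) : xt u + 4 / 9 ≤ (11030810 / 567) / u ^ 2 := by
  have hQ := Q_pos hu.le
  have hprod := shift_mul hu.le (4 / 9)
  have hxb : 7 / 36 < xb u + 4 / 9 := by linarith [xb_gt hu]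
  have hxt : 0 < xt u + 4 / 9 := by linarith [xt_gt hu]
  have hB : CoeffList.eval u cB49 = 81 * (CoeffList.eval u cP2 + 4 / 9 * CoeffList.eval u cP1 +
      (4 / 9) ^ 2 * CoeffList.eval u cQ) := by
    simp only [cB49, CoeffList.eval_add, CoeffList.eval_smul]; push_cast; ring
  have hpos : (xb u + 4 / 9) * (xt u + 4 / 9) = CoeffList.eval u cB49 / (81 * CoeffList.eval u cQ) := by
    rw [hB, hprod]; field_simp
  have hup := B49_upper hu.le
  have hQl := Q_lower hu.le
  have hu2 : 1 ≤ u ^ 2 := by nlinarith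
  have hu18 : (1 : ℝ) ≤ u ^ 18 := by rw [show u ^ 18 = (u ^ 2) ^ 9 by ring]; exact one_le_pow₀ hu2
  have h1 : (7 / 36) * (xt u + 4 / 9) ≤ (xb u + 4 / 9) * (xt u + 4 / 9) :=
    mul_le_mul_of_nonneg_right hxb.le hxt.le
  rw [hpos] at h1
  have hB49pos : 0 < CoeffList.eval u cB49 := B49_pos hu
  have h2 : CoeffList.eval u cB49 / (81 * CoeffList.eval u cQ) ≤ 11030810 * u ^ 16 / (81 * (36 * u ^ 18)) := by
    apply div_le_div₀ (by positivity) hup (by nlinarith) (by nlinarith)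
  have h3 : (11030810 : ℝ) * u ^ 16 / (81 * (36 * u ^ 18)) = 11030810 / (81 * 36) / u ^ 2 := by
    field_simp
  rw [h3] at h2
  have h4 : xt u + 4 / 9 ≤ (11030810 / (81 * 36) / u ^ 2) / (7 / 36) := by
    rw [le_div_iff₀ (by norm_num : (0:ℝ) < 7 / 36)]; linarith
  calc xt u + 4 / 9 ≤ (11030810 / (81 * 36) / u ^ 2) / (7 / 36) := h4
    _ = (11030810 / 567) / u ^ 2 := by field_simp; ring

/-- For every `ε > 0` there is `u₀ < a` (any `a ≤ −1`) with `K/u₀² < ε`. [folklore] -/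
theorem exists_sq_bound (K ε a : ℝ) (hK : 0 < K) (hε : 0 < ε) (ha : a ≤ -1) :
    ∃ u₀ : ℝ, u₀ < a ∧ K / u₀ ^ 2 < ε := by
  refine ⟨-(Real.sqrt (K / ε) + 1) + (a + 1), by have := Real.sqrt_pos.mpr (div_pos hK hε); linarith, ?_⟩
  have hs : 0 ≤ Real.sqrt (K / ε) := Real.sqrt_nonneg _
  have hsq : Real.sqrt (K / ε) ^ 2 = K / ε := Real.sq_sqrt (div_pos hK hε).le
  have hbig : K / ε < (-(Real.sqrt (K / ε) + 1) + (a + 1)) ^ 2 := by nlinarith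
  rw [div_lt_iff₀ (by nlinarith)]
  calc K = (K / ε) * ε := by field_simp
    _ < _ ^ 2 * ε := by exact mul_lt_mul_of_pos_right hbig hε
    _ = ε * _ ^ 2 := by ring

/-- **Image of the big branch**: `x_b` maps `(−∞,−1)` onto `(−1/4, 0)`.
[evidence: stmt-KontsevichZagierPeriods-14655 REPORT.md §4] -/
theorem image_xb : xb '' Iio (-1) = Ioo (-1 / 4) 0 := by
  apply Subset.antisymm
  · rintro _ ⟨u, hu, rfl⟩
    exact ⟨xb_gt hu, xb_lt hu⟩
  · rintro y ⟨hy1, hy2⟩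
    -- a point far left with xb u₀ < y
    obtain ⟨u₀, hu₀, hK⟩ := exists_sq_bound (100 * 115296020 / (304 * 36)) (y + 1 / 4) (-1)
      (by norm_num) (by linarith) le_rfl
    have hx₀ : xb u₀ < y := by linarith [xb_add_quarter_le hu₀]
    -- a point near -1 with y < xb u₁
    have hc : ContinuousAt xb (-1) := (hasDerivAt_xb le_rfl).continuousAt
    rw [Metric.continuousAt_iff] at hc
    obtain ⟨δ, hδ, hδ'⟩ := hc (-y) (by linarith)
    set u₁ : ℝ := -1 - min (δ / 2) ((-1 - u₀) / 2) with hu₁_def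
    have hmin_pos : 0 < min (δ / 2) ((-1 - u₀) / 2) := lt_min (by linarith) (by linarith)
    have hu₁lt : u₁ < -1 := by rw [hu₁_def]; linarith
    have hu₀u₁ : u₀ < u₁ := by
      rw [hu₁_def]; have := min_le_right (δ / 2) ((-1 - u₀) / 2); linarith
    have hdist : dist u₁ (-1) < δ := by
      rw [Real.dist_eq, hu₁_def]
      have := min_le_left (δ / 2) ((-1 - u₀) / 2)
      rw [show -1 - min (δ / 2) ((-1 - u₀) / 2) - -1 = -min (δ / 2) ((-1 - u₀) / 2) by ring, abs_neg,
        abs_of_pos hmin_pos]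
      linarith
    have hx₁ : y < xb u₁ := by
      have := hδ' hdist
      rw [xb_neg_one, Real.dist_eq, sub_zero] at this
      have := neg_lt_of_abs_lt this
      linarith
    -- intermediate value theorem on [u₀, u₁]
    have hcont : ContinuousOn xb (Icc u₀ u₁) :=
      continuousOn_xb.mono fun _ hu => le_trans hu.2 hu₁lt.le
    obtain ⟨u, hu, rfl⟩ := intermediate_value_Icc hu₀u₁.le hcont ⟨hx₀.le, hx₁.le⟩
    exact ⟨u, lt_of_le_of_lt hu.2 hu₁lt, rfl⟩

/-- **Image of the tiny branch, left piece**: `x_t` maps `(−∞, u_m)` onto `(−4/9, x_t(u_m))`.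
[evidence: stmt-KontsevichZagierPeriods-14655 REPORT.md §4] -/
theorem image_xt_left : xt '' Iio um = Ioo (-4 / 9) (xt um) := by
  have hm := um_lt
  apply Subset.antisymm
  · rintro _ ⟨u, hu, rfl⟩
    have hu' : u < -1 := lt_trans hu hm
    exact ⟨xt_gt hu', strictMonoOn_xt (Set.mem_Iic.mpr hu.le) (Set.mem_Iic.mpr le_rfl) hu⟩
  · rintro y ⟨hy1, hy2⟩
    obtain ⟨u₀, hu₀, hK⟩ := exists_sq_bound (11030810 / 567) (y + 4 / 9) um (by norm_num) (by linarith) hm.le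
    have hu₀' : u₀ < -1 := lt_trans hu₀ hm
    have hx₀ : xt u₀ < y := by linarith [xt_add_le hu₀']
    have hcont : ContinuousOn xt (Icc u₀ um) := continuousOn_xt.mono fun _ hu => le_trans hu.2 hm.le
    obtain ⟨u, hu, hux⟩ := intermediate_value_Icc hu₀.le hcont ⟨hx₀.le, hy2.le⟩
    refine ⟨u, lt_of_le_of_ne hu.2 ?_, hux⟩
    rintro rfl
    exact absurd hux hy2.ne'

/-- **Image of the tiny branch, right piece**: `x_t` maps `(u_m, −1)` onto `(−4/9, x_t(u_m))` —
the same interval (the branch runs out and back). [evidence: stmt-KontsevichZagierPeriods-14655 REPORT.md §4] -/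
theorem image_xt_right : xt '' Ioo um (-1) = Ioo (-4 / 9) (xt um) := by
  have hm := um_lt
  apply Subset.antisymm
  · rintro _ ⟨u, hu, rfl⟩
    exact ⟨xt_gt hu.2, strictAntiOn_xt ⟨le_rfl, hm.le⟩ ⟨hu.1.le, hu.2.le⟩ hu.1⟩
  · rintro y ⟨hy1, hy2⟩
    have hcont : ContinuousOn xt (Icc um (-1)) := continuousOn_xt.mono Icc_subset_Iic_self
    have h := intermediate_value_Icc' hm.le hcont
    rw [xt_neg_one] at h
    obtain ⟨u, hu, hux⟩ := h ⟨hy1.le, hy2.le⟩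
    refine ⟨u, ⟨lt_of_le_of_ne hu.1 ?_, lt_of_le_of_ne hu.2 ?_⟩, hux⟩
    · rintro rfl; exact absurd hux hy2.ne'
    · rintro rfl; rw [xt_neg_one] at hux; exact absurd hux hy1.ne

end Images

end Summit.KontsevichZagierPeriods.IsogenyCertificates.JLPair
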